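import Mathlib
import Summits.RiemannHypothesis.RiemannHypothesis.Theorems.WeilFarFloorSecondOrderLawRH
import Summits.RiemannHypothesis.RiemannHypothesis.Theorems.WeilFarFloorResidualEnergy
import Summits.RiemannHypothesis.RiemannHypothesis.Theorems.WeilFarFloorCoshCouplingCramerRH
import HarnessLib

/-!
# The floor gap is `O(a·e^{−a})` under RH: the second-order law with Cramér's mean square

Helper file (`--supports stmt-RiemannHypothesis-0098`, lead-track anchor: Weil-positivity window ladder, format-C far bound),
pure proofs.  Seat rh-explicit-weil-1 gen15 (memo `run/shared/lean/pub/rh-explicit/rh-explicit-weil-1/FORMAT-K3.md` §16.6).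

★ `farCoercivityFloor_sub_coshQuotient_le_linear_of_RH`: `RH → ∃ C a₀, ∀ a ≥ a₀, λ_max(a) ≤ R_c(a) + C·(a + 1)·e^{−a}` — the SHARP
ORDER of the gap (weil-1 gen14's `WeilFarFloorCoshOptimalRateSharpRH`, there via the RK/RA route behind unbuilt parents), here in
three lines from the second-order law (`WeilFarFloorSecondOrderLawRH`, `ε = 1`: `λ_max ≤ R_c + 2J/R_c + e^{−a}`), the projection
minimality of the residual energy (`WeilFarFloorResidualEnergy.setIntegral_residual_sq_le`: `J·P ≤ ∫_{(−a,a)}(T_aC_a − λC_a)²` for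
every `λ`), Cramér's mean square under RH (`WeilFarFloorCoshCouplingCramerRH`: that integral at `λ = e^a + 2a − 1` is
`≤ K(a+1)P`), and `R_c(a) ≥ e^a/2` (`coshQuotient_ge_of_RH`).  With the lower half (`WeilFarFloorSecondOrderLowerRH`) the gap is
`(1 + o(1))J(a)/R_c(a)`, `J(a) ≤ K(a + 1)`.  Standard axioms only.
-/

set_option linter.dupNamespace false
set_option autoImplicit false

noncomputable section

open MeasureTheory Set Filter
open scoped Real Topology ArithmeticFunction.vonMangoldt

namespace Summit.RiemannHypothesis.RiemannHypothesis.Theorems.WeilFormatC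

namespace FloorCoshSplit

open Literature.NumberTheory.LFunctions FloorCosh FloorEnvelope

/-- **The residual energy is `O(a)` under RH (Cramér)**: `RH → ∃ K > 0, ∀ a ≥ 1, ∫_{(−a,a)}(T_aC_a − R_c(a)C_a)² ≤ K(a+1)(a + sinh a)`,
i.e. `J(a) ≤ K(a + 1)` (projection minimality + `WeilFarFloorCoshCouplingCramerRH`). -/
theorem residualEnergy_le_linear_of_RH (hRH : RiemannHypothesis) :
    ∃ K : ℝ, 0 < K ∧ ∀ b : ℝ, 1 ≤ b →
      ∫ x in Ioo (-b) b, ((∑ n ∈ weilPrimeIndex b, (Λ n : ℝ) / Real.sqrt n *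
          ((Icc (-b) b).indicator (fun y ↦ Real.cosh (y / 2)) (x - Real.log n)
            + (Icc (-b) b).indicator (fun y ↦ Real.cosh (y / 2)) (x + Real.log n)))
          - primeShiftForm b ((Icc (-b) b).indicator (fun y ↦ Real.cosh (y / 2))) / (b + Real.sinh b)
            * (Icc (-b) b).indicator (fun y ↦ Real.cosh (y / 2)) x) ^ 2
        ≤ K * (b + 1) * (b + Real.sinh b) := by
  obtain ⟨K, hK, h⟩ := integral_primeShiftOp_coshProfile_sub_sharp_sq_le_of_RH hRH
  refine ⟨K, hK, fun b hb ↦ ?_⟩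
  obtain ⟨-, hle⟩ := h b hb
  exact (setIntegral_residual_sq_le (by linarith) (Real.exp b + 2 * b - 1)).trans hle

/-- ★ **THE FLOOR GAP IS `O(a·e^{−a})` UNDER RH**:
`RiemannHypothesis → ∃ C a₀, ∀ a ≥ a₀, λ_max(a) ≤ Q_a(C_a)/(a + sinh a) + C·(a + 1)·e^{−a}`
(second-order law with `ε = 1`, `J(a) ≤ K(a+1)` by Cramér, `R_c(a) ≥ e^a/2` eventually; `C = 4K + 1`). -/
theorem farCoercivityFloor_sub_coshQuotient_le_linear_of_RH (hRH : RiemannHypothesis) :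
    ∃ C a₀ : ℝ, ∀ a : ℝ, a₀ ≤ a →
      farCoercivityFloor a
        ≤ primeShiftForm a ((Icc (-a) a).indicator (fun y ↦ Real.cosh (y / 2))) / (a + Real.sinh a)
          + C * (a + 1) * Real.exp (-a) := by
  obtain ⟨K, hK, hJ⟩ := residualEnergy_le_linear_of_RH hRH
  obtain ⟨Cq, hCq0, hRlow⟩ := coshQuotient_ge_of_RH hRH
  obtain ⟨a₀, ha₀⟩ := farCoercivityFloor_le_coshQuotient_add_secondOrder_of_RH hRH one_pos
  -- the threshold: `C_q(a³ + 1) ≤ e^a/2`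
  have hΦ : Tendsto (fun a : ℝ ↦ (a ^ 3 + 1) * Real.exp (-a)) atTop (𝓝 0) := by
    have h := (Real.tendsto_pow_mul_exp_neg_atTop_nhds_zero 3).add Real.tendsto_exp_neg_atTop_nhds_zero
    rw [add_zero] at h
    exact h.congr' (Eventually.of_forall fun a ↦ by ring)
  have hc0 : (0 : ℝ) < 1 / (2 * (Cq + 1)) := by positivity
  obtain ⟨a₁, ha₁⟩ := Filter.eventually_atTop.1 (hΦ.eventually (Iio_mem_nhds hc0))
  refine ⟨4 * K + 1, max (max a₀ a₁) 1, fun a ha ↦ ?_⟩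
  have ha0' : a₀ ≤ a := le_trans (le_trans (le_max_left _ _) (le_max_left _ _)) ha
  have ha1' : a₁ ≤ a := le_trans (le_trans (le_max_right _ _) (le_max_left _ _)) ha
  have ha1 : 1 ≤ a := le_trans (le_max_right _ _) ha
  have ha0 : 0 < a := by linarith only [ha1]
  set X := Real.exp a with hX
  set t := Real.exp (-a) with ht
  have hX0 : 0 < X := Real.exp_pos _
  have ht0 : 0 < t := Real.exp_pos _
  have hXt : X * t = 1 := by rw [hX, ht, ← Real.exp_add]; simp
  set P := a + Real.sinh a with hP
  have hP0 : 0 < P := by have := Real.sinh_pos_iff.2 ha0; rw [hP]; linarith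
  set C : ℝ → ℝ := (Icc (-a) a).indicator (fun y ↦ Real.cosh (y / 2)) with hCdef
  set R := primeShiftForm a C / P with hR
  set I := ∫ x in Ioo (-a) a, ((∑ n ∈ weilPrimeIndex a, (Λ n : ℝ) / Real.sqrt n *
      (C (x - Real.log n) + C (x + Real.log n))) - R * C x) ^ 2 with hI
  have hI0 : 0 ≤ I := setIntegral_nonneg measurableSet_Ioo fun x _ ↦ sq_nonneg _
  -- `R ≥ X/2`
  have hΦa : (a ^ 3 + 1) * t < 1 / (2 * (Cq + 1)) := ha₁ a ha1'
  have hRlo : X - Cq * (a ^ 3 + 1) ≤ R := by rw [hR, hP, hCdef, hX]; exact hRlow a ha1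
  have hCqt : Cq * (a ^ 3 + 1) ≤ X / 2 := by
    have e : Cq * (a ^ 3 + 1) = Cq * ((a ^ 3 + 1) * t) * X := by
      have : Cq * ((a ^ 3 + 1) * t) * X = Cq * (a ^ 3 + 1) * (X * t) := by ring
      rw [this, hXt, mul_one]
    rw [e]
    have h2 : Cq * ((a ^ 3 + 1) * t) ≤ Cq * (1 / (2 * (Cq + 1))) := mul_le_mul_of_nonneg_left hΦa.le hCq0
    have h3 : Cq * (1 / (2 * (Cq + 1))) ≤ 1 / 2 := by
      rw [mul_one_div, div_le_iff₀ (by positivity)]; linarith only [hCq0]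
    nlinarith only [h2, h3, hX0]
  have hRX : X / 2 ≤ R := by linarith only [hRlo, hCqt]
  have hR0 : 0 < R := by linarith only [hRX, hX0]
  -- `J = I/P ≤ K(a+1)`
  have hIle : I ≤ K * (a + 1) * P := by rw [hI, hR, hP, hCdef]; exact hJ a ha1
  have hJle : I / P ≤ K * (a + 1) := by rw [div_le_iff₀ hP0]; exact hIle
  -- the second-order law with `ε = 1`
  have hlaw := ha₀ a ha0'
  rw [← hCdef, ← hP, ← hR, ← hI] at hlaw
  -- `2·(I/P)/R ≤ 2K(a+1)·(2/X) = 4K(a+1)·t`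
  have h2 : (1 + 1) * (I / P) / R ≤ 4 * K * (a + 1) * t := by
    have h3 : (1 + 1) * (I / P) / R ≤ (1 + 1) * (K * (a + 1)) / (X / 2) :=
      div_le_div₀ (by positivity) (by linarith only [hJle]) (by positivity) hRX
    have e : (1 + 1) * (K * (a + 1)) / (X / 2) = 4 * K * (a + 1) * t := by
      have : t = 1 / X := by field_simp; linarith only [hXt]
      rw [this]; field_simp; ring
    linarith only [h3, e.le]
  have h6 : 1 * t ≤ 1 * (a + 1) * t := by nlinarith only [ha0, ht0]
  have e2 : (4 * K + 1) * (a + 1) * t = 4 * K * (a + 1) * t + 1 * (a + 1) * t := by ring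
  rw [e2]
  linarith only [hlaw, h2, h6]

/-- ★ **The gap is `O(a·e^{−a})` and the coefficient is the residual energy `J ≤ K(a+1)`**: under RH there are `C, a₀` with
`0 ≤ λ_max(a) − Q_a(C_a)/(a + sinh a) ≤ C·(a + 1)·e^{−a}` for all `a ≥ a₀`. -/
theorem abs_farCoercivityFloor_sub_coshQuotient_le_linear_of_RH (hRH : RiemannHypothesis) :
    ∃ C a₀ : ℝ, ∀ a : ℝ, a₀ ≤ a →
      0 ≤ farCoercivityFloor a - primeShiftForm a ((Icc (-a) a).indicator (fun y ↦ Real.cosh (y / 2))) / (a + Real.sinh a) ∧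
      farCoercivityFloor a - primeShiftForm a ((Icc (-a) a).indicator (fun y ↦ Real.cosh (y / 2))) / (a + Real.sinh a)
        ≤ C * (a + 1) * Real.exp (-a) := by
  obtain ⟨C, a₀, h⟩ := farCoercivityFloor_sub_coshQuotient_le_linear_of_RH hRH
  refine ⟨C, max a₀ 1, fun a ha ↦ ⟨?_, by linarith only [h a (le_trans (le_max_left _ _) ha)]⟩⟩
  have h2 := coshQuotient_le_farCoercivityFloor (a := a) (by linarith only [le_trans (le_max_right _ _) ha])
  linarith only [h2]

end FloorCoshSplit

end Summit.RiemannHypothesis.RiemannHypothesis.Theorems.WeilFormatC
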